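import Summits.Ventures.QEC.CircuitDistance.PortSectorFinal
import Summits.Ventures.QEC.CircuitDistance.SchedZSector
import HarnessLib

/-!
# Q4 lane, ₛ-spine (9F): the SECTOR THEOREMS in dischargeable form for any CNOT order (`PortSectorFinal.lean` re-pointed to
# `xDEMₛ/zDEMₛ σ` under `hσ : σ.CycleFacts S`; venture QEC, experiment cell CDX, seat qec-cdx-type-2; proofs verbatim; nothing here
# asserts a value of `d_circ`)

Reused unchanged (order-free): `IsXClass`/`IsZClass`, `isClass_of_mem_proj`, the budget-aware checkers `XTable.covers₀`/`ZTable.covers₀`,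
`word_map_toFinset`. Re-pointed: `isXClass_of_clsₛ`/`isZClass_of_clsₛ`, **`xcovers₀_soundₛ`/`zcovers₀_soundₛ`**,
**`no_xLogical_of_leaves₀ₛ`/`no_zLogical_of_leaves₀ₛ (hσ)`** (completeness over CLASS-words; leaves refuted as `¬ Realised`).
-/

namespace Summit.Ventures.QEC.CircuitDistance

open Literature.InformationTheory.QuantumCodes

variable {ℓ m : ℕ} [NeZero ℓ] [NeZero m]


/-- Every class of a column of the `X`-sector DEM of `σ` is an `X`-class (cf. `isXClass_of_cls`). -/
theorem isXClass_of_clsₛ (σ : SMSchedule) (S : SMCode ℓ m) (T : XTable ℓ m) (Nc : ℕ) (f : Fault ℓ m)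
    (g : Finset (BB.Mono ℓ m ⊕ BB.Mono ℓ m)) (h : (xDEMₛ σ S T Nc).cls f = some g) : IsXClass T g := by
  change (f.xKind.bind fun ki => (T.cls ki.1).map (trQ ki.2)) = some g at h
  rcases hk : f.xKind with _ | ⟨k, i⟩
  · rw [hk] at h; simp at h
  · rw [hk, Option.bind_some] at h
    exact ⟨k, XKind.mem_all k (fun lay => Fault.xKind_ne_zero hk lay), i, h⟩

/-- Every class of a column of the `Z`-sector DEM of `σ` is a `Z`-class (cf. `isZClass_of_cls`). -/
theorem isZClass_of_clsₛ (σ : SMSchedule) (S : SMCode ℓ m) (T : ZTable ℓ m) (Nc : ℕ) (f : Fault ℓ m)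
    (g : Finset (BB.Mono ℓ m ⊕ BB.Mono ℓ m)) (h : (zDEMₛ σ S T Nc).cls f = some g) : IsZClass T g := by
  change (f.zKind.bind fun ki => (T.cls ki.1).map (trQ ki.2)) = some g at h
  rcases hk : f.zKind with _ | ⟨k, i⟩
  · rw [hk] at h; simp at h
  · rw [hk, Option.bind_some] at h
    exact ⟨k, ZKind.mem_all k (fun lay => Fault.zKind_ne_zero hk lay), i, h⟩

/-! ## Budget-aware coverage (the checkers `XTable.covers₀`/`ZTable.covers₀` of the tree are order-free and reused) -/

/-- **Coverage soundness** (`X`, budget-aware), any order with the cycle facts (cf. `xcovers₀_sound`). -/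
theorem xcovers₀_soundₛ {σ : SMSchedule} {S : SMCode ℓ m} (hσ : σ.CycleFacts S) (T : XTable ℓ m) (hS : T.ShapeCorrectₛ σ S)
    (Nc : ℕ) (e : LeafEntry ℓ m) (h : T.covers₀ S Nc e = true) : Fibre.Covers₀ (xDEMₛ σ S T Nc) (scope Nc) encDet e.word e.leaf := by
  unfold XTable.covers₀ at h
  simp only [Bool.and_eq_true, decide_eq_true_eq, List.all_eq_true] at h
  obtain ⟨hlen, hall⟩ := h
  refine ⟨encDet_injective, hlen, fun f hf j hcls => ?_, ?_⟩
  · obtain ⟨h₁, h₂⟩ := hf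
    change (f.xKind.bind fun ki => (T.cls ki.1).map (trQ ki.2)) = some e.word[j] at hcls
    rcases hk : f.xKind with _ | ⟨k, i⟩
    · rw [hk] at hcls; simp at hcls
    · rw [hk, Option.bind_some] at hcls
      have hkall : k ∈ XKind.all := XKind.mem_all k (fun lay => Fault.xKind_ne_zero hk lay)
      have hki := hall (k, i) (List.pair_mem_product.2 ⟨hkall, mem_monoList i⟩)
      simp only [hcls] at hki
      rw [List.all_eq_true] at hki
      have hj := hki j (List.mem_range.2 j.2)
      simp only [Bool.or_eq_true, Bool.not_eq_true', decide_eq_false_iff_not, List.all_eq_true, List.any_eq_true,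
        decide_eq_true_eq] at hj
      rcases hj with hj | hj
      · exact absurd (List.getElem?_eq_getElem j.2) hj
      · obtain ⟨c, hc, hcc⟩ := hj (f.cyc - 1) (List.mem_range.2 (by omega))
        refine ⟨c, hc, ?_⟩
        rw [hcc, Nat.sub_add_cancel h₁, XTable.detFast_eq_xDetₛ hσ (hS k hkall) Nc i f.cyc h₁ h₂, ← xDetₛ_eq_of_xKind σ S Nc f hk]
        rfl
  · by_cases hb : e.leaf.budget = 0
    · exact Or.inl hb
    · refine Or.inr fun f hf hcls => ?_
      obtain ⟨h₁, h₂⟩ := hf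
      change (f.xKind.bind fun ki => (T.cls ki.1).map (trQ ki.2)) = none at hcls
      rcases hk : f.xKind with _ | ⟨k, i⟩
      · exact Or.inl (xDetₛ_eq_empty_of_xKind σ S Nc f hk)
      · rw [hk, Option.bind_some] at hcls
        have hkall : k ∈ XKind.all := XKind.mem_all k (fun lay => Fault.xKind_ne_zero hk lay)
        have hki := hall (k, i) (List.pair_mem_product.2 ⟨hkall, mem_monoList i⟩)
        simp only [hcls, hb, decide_false, Bool.false_or] at hki
        rw [List.all_eq_true] at hki
        have hc := hki (f.cyc - 1) (List.mem_range.2 (by omega))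
        simp only [Bool.or_eq_true, decide_eq_true_eq, List.any_eq_true] at hc
        have hcol : (T.detFast S Nc k i (f.cyc - 1 + 1)).image encDet = (xDetₛ σ S Nc f).image encDet := by
          rw [Nat.sub_add_cancel h₁, XTable.detFast_eq_xDetₛ hσ (hS k hkall) Nc i f.cyc h₁ h₂, ← xDetₛ_eq_of_xKind σ S Nc f hk]
        rcases hc with hc | ⟨c, hcn, hcc⟩
        · left; rw [hcol, Finset.image_eq_empty] at hc; exact hc
        · right; exact ⟨c, hcn, by rw [hcc, hcol]; rfl⟩

/-- **Coverage soundness** (`Z`, budget-aware), any order with the cycle facts (cf. `zcovers₀_sound`). -/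
theorem zcovers₀_soundₛ {σ : SMSchedule} {S : SMCode ℓ m} (hσ : σ.CycleFacts S) (T : ZTable ℓ m) (hS : T.ShapeCorrectₛ σ S)
    (Nc : ℕ) (e : LeafEntry ℓ m) (h : T.covers₀ S Nc e = true) : Fibre.Covers₀ (zDEMₛ σ S T Nc) (scope Nc) encDet e.word e.leaf := by
  unfold ZTable.covers₀ at h
  simp only [Bool.and_eq_true, decide_eq_true_eq, List.all_eq_true] at h
  obtain ⟨hlen, hall⟩ := h
  refine ⟨encDet_injective, hlen, fun f hf j hcls => ?_, ?_⟩
  · obtain ⟨h₁, h₂⟩ := hf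
    change (f.zKind.bind fun ki => (T.cls ki.1).map (trQ ki.2)) = some e.word[j] at hcls
    rcases hk : f.zKind with _ | ⟨k, i⟩
    · rw [hk] at hcls; simp at hcls
    · rw [hk, Option.bind_some] at hcls
      have hkall : k ∈ ZKind.all := ZKind.mem_all k (fun lay => Fault.zKind_ne_zero hk lay)
      have hki := hall (k, i) (List.pair_mem_product.2 ⟨hkall, mem_monoList i⟩)
      simp only [hcls] at hki
      rw [List.all_eq_true] at hki
      have hj := hki j (List.mem_range.2 j.2)
      simp only [Bool.or_eq_true, Bool.not_eq_true', decide_eq_false_iff_not, List.all_eq_true, List.any_eq_true,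
        decide_eq_true_eq] at hj
      rcases hj with hj | hj
      · exact absurd (List.getElem?_eq_getElem j.2) hj
      · obtain ⟨c, hc, hcc⟩ := hj (f.cyc - 1) (List.mem_range.2 (by omega))
        refine ⟨c, hc, ?_⟩
        rw [hcc, Nat.sub_add_cancel h₁, ZTable.detFast_eq_zDetₛ hσ (hS k hkall) Nc i f.cyc h₁ h₂, ← zDetₛ_eq_of_zKind σ S Nc f hk]
        rfl
  · by_cases hb : e.leaf.budget = 0
    · exact Or.inl hb
    · refine Or.inr fun f hf hcls => ?_
      obtain ⟨h₁, h₂⟩ := hf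
      change (f.zKind.bind fun ki => (T.cls ki.1).map (trQ ki.2)) = none at hcls
      rcases hk : f.zKind with _ | ⟨k, i⟩
      · exact Or.inl (zDetₛ_eq_empty_of_zKind σ S Nc f hk)
      · rw [hk, Option.bind_some] at hcls
        have hkall : k ∈ ZKind.all := ZKind.mem_all k (fun lay => Fault.zKind_ne_zero hk lay)
        have hki := hall (k, i) (List.pair_mem_product.2 ⟨hkall, mem_monoList i⟩)
        simp only [hcls, hb, decide_false, Bool.false_or] at hki
        rw [List.all_eq_true] at hki
        have hc := hki (f.cyc - 1) (List.mem_range.2 (by omega))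
        simp only [Bool.or_eq_true, decide_eq_true_eq, List.any_eq_true] at hc
        have hcol : (T.detFast S k i (f.cyc - 1 + 1)).image encDet = (zDetₛ σ S Nc f).image encDet := by
          rw [Nat.sub_add_cancel h₁, ZTable.detFast_eq_zDetₛ hσ (hS k hkall) Nc i f.cyc h₁ h₂, ← zDetₛ_eq_of_zKind σ S Nc f hk]
        rcases hc with hc | ⟨c, hcn, hcc⟩
        · left; rw [hcol, Finset.image_eq_empty] at hc; exact hc
        · right; exact ⟨c, hcn, by rw [hcc, hcol]; rfl⟩

/-! ## The sector theorems, dischargeable form -/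

/-- **`X`-SECTOR THEOREM (dischargeable form), any CNOT order with the cycle facts** (cf. `no_xLogical_of_leaves₀`): table
shape-correct FOR `σ` and class-correct; every listed leaf well-formed, covered (budget-aware), of weight `w`, budget `≤ 1` and
UNREALISED; the list COMPLETE up to translation for `X`-nontrivial CLASS-words of weight `≤ w` ⇒ no undetectable fault set of `≤ w`
operations of the `N₀`-cycle circuit of `σ` has an `X`-nontrivial residual. -/
theorem no_xLogical_of_leaves₀ₛ {σ : SMSchedule} {S : SMCode ℓ m} (hσ : σ.CycleFacts S) (T : XTable ℓ m)
    (hS : T.ShapeCorrectₛ σ S) (hC : T.ClassCorrect S) (N₀ w : ℕ) (leaves : List (LeafEntry ℓ m))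
    (hwf : ∀ e ∈ leaves, e.leaf.wf = true ∧ T.covers₀ S N₀ e = true ∧ e.word.Nodup ∧ e.leaf.w = w ∧ e.leaf.budget ≤ 1 ∧
      ¬ e.leaf.Realised)
    (hcomplete : ∀ x : Finset (Finset (BB.Mono ℓ m ⊕ BB.Mono ℓ m)), (∀ g ∈ x, IsXClass T g) →
      XNontrivial S (∑ g ∈ x, indic g) → x.card ≤ w → ∃ e ∈ leaves, ∃ t : BB.Mono ℓ m, x = (e.word.map (trQ t)).toFinset) :
    ¬ ∃ F : Finset (Fault ℓ m), Gen.Undetectable S N₀ (allEventsₛ σ N₀) F ∧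
        Gen.dataX S (allEventsₛ σ N₀) F ∉ rowSpace S.toCode.HX ∧ faultCount F ≤ w := by
  classical
  rintro ⟨F, hU, hL, hw⟩
  obtain ⟨F₁, hR, hcard, himg, hX, hZ, hdX, hdZ⟩ := Gen.exists_reduced S N₀ (allEventsₛ σ N₀) F
  have hU₁ : Gen.Undetectable S N₀ (allEventsₛ σ N₀) F₁ := by
    refine ⟨fun f' hf' => ?_, fun t i => ⟨?_, ?_⟩⟩
    · have : f'.loc ∈ F.image Fault.loc := himg (Finset.mem_image_of_mem _ hf')
      obtain ⟨f, hf, hfl⟩ := Finset.mem_image.1 this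
      rw [← Fault.ev_eq_of_loc_eq hfl]; exact hU.1 f hf
    · rw [hX]; exact (hU.2 t i).1
    · rw [hZ]; exact (hU.2 t i).2
  have hNT : XNontrivial S (Gen.dataX S (allEventsₛ σ N₀) F₁) := ⟨(residual_syndrome_zeroₛ hσ N₀ F₁ hU₁).1, by rw [hdX]; exact hL⟩
  have hscope : ∀ f ∈ F₁, f ∈ scope (ℓ := ℓ) (m := m) N₀ := by
    intro f hf
    have := hU₁.1 f hf
    rw [hσ.mem_allEventsₛ_iff, Fault.ev_cyc] at this
    exact this
  have key := Fibre.no_silent_nontrivial (xDEMₛ σ S T N₀) (scope N₀) (classHyp_xDEMₛ hσ T hS hC N₀) (XNontrivial S)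
    (fun v s hs => xNontrivial_add_stab S v s hs) w ?_ F₁ hscope (hcard.trans hw) (silent_xDEMₛ σ S T N₀ F₁ hU₁)
  · apply key
    show XNontrivial S (∑ f ∈ F₁, Gen.dataX S (allEventsₛ σ N₀) {f})
    rw [← Gen.dataX_eq_sum]; exact hNT
  intro x hx hxw
  by_cases hcl : ∀ g ∈ x, IsXClass T g
  · obtain ⟨e, he, t, rfl⟩ := hcomplete x hcl hx hxw
    obtain ⟨hwfe, hcov, hnd, hwe, hb, hnr⟩ := hwf e he
    have hcovers := xcovers₀_soundₛ hσ T hS N₀ e hcov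
    have hlen : e.word.length = e.leaf.k := hcovers.2.1
    rw [word_map_toFinset, Finset.card_map, List.toFinset_card_of_nodup hnd, hlen]
    show ¬ Fibre.TightRealisable (xDEMₛ σ S T N₀) (scope N₀) (e.word.toFinset.map (xSymmₛ σ S T N₀ t).onGen.toEmbedding) _
    rw [Fibre.tightRealisable_map_iff (xDEMₛ σ S T N₀) (scope N₀) (xSymmₛ σ S T N₀ t)]
    have hbud : w - e.leaf.k = e.leaf.budget := by unfold Fibre.Leaf.budget; rw [hwe]
    rw [hbud]
    exact Fibre.not_tightRealisable_of_notRealised₀ (xDEMₛ σ S T N₀) (scope N₀) encDet e.word hnd e.leaf hcovers hnr hb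
  · -- a non-class word is never realised
    push Not at hcl
    obtain ⟨g, hgx, hg⟩ := hcl
    rintro ⟨G, -, -, hproj, -⟩
    have hgp : g ∈ Fibre.proj (xDEMₛ σ S T N₀) G := by rw [hproj]; exact hgx
    obtain ⟨f, -, hf⟩ := isClass_of_mem_proj (xDEMₛ σ S T N₀) G g hgp
    exact hg (isXClass_of_clsₛ σ S T N₀ f g hf)

/-- **`Z`-SECTOR THEOREM (dischargeable form), any CNOT order with the cycle facts** (cf. `no_zLogical_of_leaves₀`). -/
theorem no_zLogical_of_leaves₀ₛ {σ : SMSchedule} {S : SMCode ℓ m} (hσ : σ.CycleFacts S) (T : ZTable ℓ m)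
    (hS : T.ShapeCorrectₛ σ S) (hC : T.ClassCorrect S) (N₀ w : ℕ) (leaves : List (LeafEntry ℓ m))
    (hwf : ∀ e ∈ leaves, e.leaf.wf = true ∧ T.covers₀ S N₀ e = true ∧ e.word.Nodup ∧ e.leaf.w = w ∧ e.leaf.budget ≤ 1 ∧
      ¬ e.leaf.Realised)
    (hcomplete : ∀ x : Finset (Finset (BB.Mono ℓ m ⊕ BB.Mono ℓ m)), (∀ g ∈ x, IsZClass T g) →
      ZNontrivial S (∑ g ∈ x, indic g) → x.card ≤ w → ∃ e ∈ leaves, ∃ t : BB.Mono ℓ m, x = (e.word.map (trQ t)).toFinset) :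
    ¬ ∃ F : Finset (Fault ℓ m), Gen.Undetectable S N₀ (allEventsₛ σ N₀) F ∧
        Gen.dataZ S (allEventsₛ σ N₀) F ∉ rowSpace S.toCode.HZ ∧ faultCount F ≤ w := by
  classical
  rintro ⟨F, hU, hL, hw⟩
  obtain ⟨F₁, hR, hcard, himg, hX, hZ, hdX, hdZ⟩ := Gen.exists_reduced S N₀ (allEventsₛ σ N₀) F
  have hU₁ : Gen.Undetectable S N₀ (allEventsₛ σ N₀) F₁ := by
    refine ⟨fun f' hf' => ?_, fun t i => ⟨?_, ?_⟩⟩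
    · have : f'.loc ∈ F.image Fault.loc := himg (Finset.mem_image_of_mem _ hf')
      obtain ⟨f, hf, hfl⟩ := Finset.mem_image.1 this
      rw [← Fault.ev_eq_of_loc_eq hfl]; exact hU.1 f hf
    · rw [hX]; exact (hU.2 t i).1
    · rw [hZ]; exact (hU.2 t i).2
  have hNT : ZNontrivial S (Gen.dataZ S (allEventsₛ σ N₀) F₁) := ⟨(residual_syndrome_zeroₛ hσ N₀ F₁ hU₁).2, by rw [hdZ]; exact hL⟩
  have hscope : ∀ f ∈ F₁, f ∈ scope (ℓ := ℓ) (m := m) N₀ := by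
    intro f hf
    have := hU₁.1 f hf
    rw [hσ.mem_allEventsₛ_iff, Fault.ev_cyc] at this
    exact this
  have key := Fibre.no_silent_nontrivial (zDEMₛ σ S T N₀) (scope N₀) (classHyp_zDEMₛ hσ T hS hC N₀) (ZNontrivial S)
    (fun v s hs => zNontrivial_add_stab S v s hs) w ?_ F₁ hscope (hcard.trans hw) (silent_zDEMₛ σ S T N₀ F₁ hU₁)
  · apply key
    show ZNontrivial S (∑ f ∈ F₁, Gen.dataZ S (allEventsₛ σ N₀) {f})
    rw [← Gen.dataZ_eq_sum]; exact hNT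
  intro x hx hxw
  by_cases hcl : ∀ g ∈ x, IsZClass T g
  · obtain ⟨e, he, t, rfl⟩ := hcomplete x hcl hx hxw
    obtain ⟨hwfe, hcov, hnd, hwe, hb, hnr⟩ := hwf e he
    have hcovers := zcovers₀_soundₛ hσ T hS N₀ e hcov
    have hlen : e.word.length = e.leaf.k := hcovers.2.1
    rw [word_map_toFinset, Finset.card_map, List.toFinset_card_of_nodup hnd, hlen]
    show ¬ Fibre.TightRealisable (zDEMₛ σ S T N₀) (scope N₀) (e.word.toFinset.map (zSymmₛ σ S T N₀ t).onGen.toEmbedding) _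
    rw [Fibre.tightRealisable_map_iff (zDEMₛ σ S T N₀) (scope N₀) (zSymmₛ σ S T N₀ t)]
    have hbud : w - e.leaf.k = e.leaf.budget := by unfold Fibre.Leaf.budget; rw [hwe]
    rw [hbud]
    exact Fibre.not_tightRealisable_of_notRealised₀ (zDEMₛ σ S T N₀) (scope N₀) encDet e.word hnd e.leaf hcovers hnr hb
  · push Not at hcl
    obtain ⟨g, hgx, hg⟩ := hcl
    rintro ⟨G, -, -, hproj, -⟩
    have hgp : g ∈ Fibre.proj (zDEMₛ σ S T N₀) G := by rw [hproj]; exact hgx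
    obtain ⟨f, -, hf⟩ := isClass_of_mem_proj (zDEMₛ σ S T N₀) G g hgp
    exact hg (isZClass_of_clsₛ σ S T N₀ f g hf)

end Summit.Ventures.QEC.CircuitDistance
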